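import Summits.BirchSwinnertonDyer.Rank1Residual.Additive.PadicLogImage
import Summits.BirchSwinnertonDyer.Rank1Residual.X11b.Three.GoodReductionSubgroupCuspPadic
import HarnessLib

/-!
# The local index at an ADDITIVE prime of `E/ℚ`, points side, in the cell's currency:
# `log(E(ℚ_p)) = p^{t − ord_p c_p} ℤ_p` for `W/ℚ` globally minimal with `Addv W p` (`ClassX4`, `ClassX3`;
# `p = 3` included) (cell `b2b-bsdres`, team n1011, row T-R1-24 = ROUTE-1 §20.8 R1-24; seat n1011-p05 gen 3)

HONEST FRAMING (cell `b2b-bsdres`, run/shared/lean/b2b/bsd-rank1-residual/, verbatim in every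
file): the goal of the cell is to DELETE the COMBINATION-SHAPED residual classes of the
Birch–Swinnerton-Dyer formula for ALL analytic-rank `≤ 1` elliptic curves over `ℚ` — "full BSD
formula for every rank `≤ 1` curve in class `C`" assembled STRICTLY from published theorems — so
that the rank-`≤ 1` remainder becomes exactly the CONSTRUCTION-SHAPED classes, which are TYPED
(missing-input `Prop`s), NOT attempted. This is not "finishing BSD". Team n1011 (X4 ∧ `p = 3`,
§I N10/N11; ROUTE-1 (a′) of planner r1): research route; TOOL theorems on local points, no class
theorem (X4/X3 labels unchanged); no definition, no named fact; nothing booked.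

## What

`Additive/PadicLogImage.lean` proves, for a `ℤ_p`-minimal elliptic `X/ℚ_p`,
`log(E(ℚ_p)) = p^{1 + t − v_p c_p − v_p #Ẽ_ns(𝔽_p)} ℤ_p` (`padicLog X : E(ℚ_p) →+ ℚ_p` the
`ℤ_p`-linear extension of the formal-group logarithm, `p^t` the `p`-part of `#E(ℚ_p)_tors`), and
`= p^{t − v_p c_p} ℤ_p` at additive reduction.  This file reads it on the globally minimal `W/ℚ`
and the cell's predicates (`Addv W p`, `ClassX4 W p`, `ClassX3 W p` of `Rank1Residual/Predicates`),
with `E(ℚ_p) = (W.baseChange ℚ_[p]).toAffine.Point`, `c_p = (W.baseChange ℚ_[p]).localTamagawaNumber ℤ_[p]`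
(x11b's currency) and `#Ẽ_ns(𝔽_p) = reductionPointCount W p`:

* `hasAdditiveReduction_baseChange_padic_of_addv` — `Addv W p ⟹ W ⊗ ℚ_p` is additive over `ℤ_[p]`
  (x11b3-p4's `hasAdditiveReduction_baseChange_padic_of_not_good_of_not_mult`, by name);
* `reductionPointCount_of_addv` — **`#Ẽ_ns(𝔽_p) = p` at an additive prime** (twin of x11b's
  `reductionPointCount_of_mult`: `p ∓ 1` at a multiplicative one);
* `range_padicLog_baseChange` — any prime: `log(E(ℚ_p)) = p^{1 + t − v_p c_p − v_p #Ẽ_ns(𝔽_p)} ℤ_p`;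
  `range_padicLog_baseChange_of_mult` — multiplicative prime: `p^{1 + t − v_p c_p} ℤ_p` (x11b rows, no (iv));
  `range_padicLog_baseChange_of_good` — good prime: `p^{1 + t − v_p #Ẽ(𝔽_p)} ℤ_p` (anomalous primes visible);
* **`range_padicLog_baseChange_of_addv` — `Addv W p ⟹ log(E(ℚ_p)) = p^{t − v_p c_p} ℤ_p`**, the
  POINTS SIDE of ROUTE-1 (I2) `exp*_ω(H¹_s(ℚ_p,T)) = p^{v_p c_p − t} ℤ_p`; `…_of_classX4`,
  `…_of_classX3` (the N10/N11 and X3 rows; no image hypothesis is used);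
* `range_padicLog_baseChange_of_addv_of_not_dvd` — Kim's Lemma 3.10 regime `p ∤ c_p`: `p^t ℤ_p`;
* §3 `forall_norm_mul_le_one_iff_mem_span_zpow_neg` (the multiplication-dual of `p^aℤ_p` is
  `p^{−a}ℤ_p`) and **`dual_range_padicLog_baseChange_of_addv`**: the dual lattice of `log(E(ℚ_p))` is
  `p^{v_p c_p − t} ℤ_p` — (I2) MODULO the typed dictionary `exp*_ω(H¹_s) = log_ω(E(ℚ_p))^∨`.

The GALOIS half of (I2) (`H¹_f = E(ℚ_p) ⊗ ℤ_p`, `exp* = log^∨`) is NOT here (typed DICT3, ROUTE-1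
R1-21): see the module docstring of `PadicLogImage`.

References: [Kim2022StructureSelmer] §3.2.3, Rem. 3.8, Lemma 3.10 (PDF pp. 16–17);
[SilvermanAEC2009] III.2.5/Ex. 3.5, IV.6.4, VII.2.1, VII.5.1, VII.6.1, VII.6.3.
-/

noncomputable section

open scoped Classical

namespace Summit.BirchSwinnertonDyer.Rank1Residual.Additive.LocalLog

open WeierstrassCurve Literature.NumberTheory.EllipticCurves
  Literature.NumberTheory.EllipticCurves.Rank1Residual
  Summit.BirchSwinnertonDyer.Rank1Residual.X11b

variable (W : WeierstrassCurve ℚ) [W.IsElliptic] [W.IsGloballyMinimal] (p : ℕ) [hp : Fact p.Prime]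

/-! ## §1 Additive reduction at `p` read on `W ⊗ ℚ_p`; `#Ẽ_ns(𝔽_p) = p` -/

/-- **`Addv W p ⟹ W ⊗ ℚ_p` has additive reduction over `ℤ_[p]`** (the cell's `Addv` negates the
good / multiplicative classes of the chosen `ℤ_p`-minimal model; x11b3-p4's
`hasAdditiveReduction_baseChange_padic_of_not_good_of_not_mult` moves it to the global minimal
equation itself). [cite: SilvermanAEC2009, VII.1 Prop. 1.3(b) and VII.5 Prop. 5.1 (PDF pp. 165, 174)] -/
theorem hasAdditiveReduction_baseChange_padic_of_addv (hadd : Addv W p) :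
    (W.baseChange ℚ_[p]).HasAdditiveReduction ℤ_[p] :=
  Three.JetchevKummer.hasAdditiveReduction_baseChange_padic_of_not_good_of_not_mult W p hadd.1 hadd.2

/-- **`#Ẽ_ns(𝔽_p) = p` at an additive prime** for the tree's `reductionPointCount W p`
(Silverman *AEC* Ex. 3.5: `Ẽ_ns ≅ 𝔾_a` at a cusp). [cite: SilvermanAEC2009, Prop. III.2.5 and Exercise 3.5 (PDF pp. 59, 97)] -/
theorem reductionPointCount_of_addv (hadd : Addv W p) : reductionPointCount W p = p := by
  haveI := hasAdditiveReduction_baseChange_padic_of_addv W p hadd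
  rw [← LocalTorsion.natCard_point_reduction_baseChange_padic W p]
  exact natCard_point_reduction_of_hasAdditiveReduction (W.baseChange ℚ_[p])

/-- `p ∣ #Ẽ_ns(𝔽_p)` at an additive prime (contrast: `p ∤ #Ẽ_ns(𝔽_p) = p ∓ 1` at a multiplicative
one, x11b `not_dvd_reductionPointCount_of_mult`). [cite: SilvermanAEC2009, Exercise 3.5 (PDF p. 97)] -/
theorem dvd_reductionPointCount_of_addv (hadd : Addv W p) : p ∣ reductionPointCount W p := by
  rw [reductionPointCount_of_addv W p hadd]

/-! ## §2 The image of the logarithm on `E(ℚ_p)` for `W/ℚ` -/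

/-- **Any prime: `log(E(ℚ_p)) = p^{1 + t − v_p c_p − v_p #Ẽ_ns(𝔽_p)} ℤ_p`** for the globally minimal
`W/ℚ` (`E(ℚ_p) = (W ⊗ ℚ_p)(ℚ_p)`, `p^t` the `p`-part of `#E(ℚ_p)_tors`, `c_p` the Tamagawa number of
`W ⊗ ℚ_p`, `#Ẽ_ns(𝔽_p) = reductionPointCount W p`). [cite: Kim2022StructureSelmer, §3.2.3 (display before Thm. 3.7, PDF p. 16)]
[cite: SilvermanAEC2009, IV.6.4, VII.2.1, VII.6.1, VII.6.3] -/
theorem range_padicLog_baseChange :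
    (padicLog (W.baseChange ℚ_[p])).range = (Submodule.span ℤ_[p] {(p : ℚ_[p]) ^
      ((1 : ℤ) + padicValNat p (Nat.card (AddCommGroup.torsion (W.baseChange ℚ_[p]).toAffine.Point)) -
        padicValNat p ((W.baseChange ℚ_[p]).localTamagawaNumber ℤ_[p]) -
        padicValNat p (reductionPointCount W p))}).toAddSubgroup := by
  rw [← LocalTorsion.natCard_point_reduction_baseChange_padic W p]
  exact range_padicLog_eq_span_zpow_of_isMinimal (W.baseChange ℚ_[p])

/-- **At a MULTIPLICATIVE prime: `log(E(ℚ_p)) = p^{1 + t − v_p c_p} ℤ_p`** (`#Ẽ_ns(𝔽_p) = p ∓ 1` is a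
`p`-unit, x11b `LocalTorsion.not_dvd_reductionPointCount_of_mult`) — the torsion-allowed form of the
lattice behind x11b's (iv)-conditioned local index (`BDPRouteLocalIndex`).
[cite: SilvermanAEC2009, IV.6.4, VII.6.1, VII.6.3 and Exercise 3.5] -/
theorem range_padicLog_baseChange_of_mult (hmult : Mult W p) :
    (padicLog (W.baseChange ℚ_[p])).range = (Submodule.span ℤ_[p] {(p : ℚ_[p]) ^
      ((1 : ℤ) + padicValNat p (Nat.card (AddCommGroup.torsion (W.baseChange ℚ_[p]).toAffine.Point)) -
        padicValNat p ((W.baseChange ℚ_[p]).localTamagawaNumber ℤ_[p]))}).toAddSubgroup := by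
  rw [range_padicLog_baseChange W p,
    padicValNat.eq_zero_of_not_dvd (LocalTorsion.not_dvd_reductionPointCount_of_mult W p hmult),
    Nat.cast_zero, sub_zero]

/-- **At a GOOD prime: `log(E(ℚ_p)) = p^{1 + t − v_p #Ẽ(𝔽_p)} ℤ_p`** (`c_p = 1`, tree
`localTamagawaNumber_eq_one_of_hasGoodReduction_holds`; `#Ẽ(𝔽_p) = reductionPointCount W p = p + 1 − a_p`):
`= p^{1+t} ℤ_p` at a non-anomalous good prime, larger at an ANOMALOUS one (`p ∣ #Ẽ(𝔽_p)`).
[cite: SilvermanAEC2009, IV.6.4, VII.2.1 (remark after Prop. 2.1), VII.6.3] -/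
theorem range_padicLog_baseChange_of_good (hgood : Good W p) :
    (padicLog (W.baseChange ℚ_[p])).range = (Submodule.span ℤ_[p] {(p : ℚ_[p]) ^
      ((1 : ℤ) + padicValNat p (Nat.card (AddCommGroup.torsion (W.baseChange ℚ_[p]).toAffine.Point)) -
        padicValNat p (reductionPointCount W p))}).toAddSubgroup := by
  have hc : (W.baseChange ℚ_[p]).localTamagawaNumber ℤ_[p] = 1 := by
    haveI : ((W.baseChange ℚ_[p]).minimal ℤ_[p]).HasGoodReduction ℤ_[p] := hgood
    exact (W.baseChange ℚ_[p]).localTamagawaNumber_eq_one_of_hasGoodReduction_holds ℤ_[p]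
  rw [range_padicLog_baseChange W p, hc, padicValNat_one_right, Nat.cast_zero, sub_zero]

/-- **THE LOCAL INDEX AT AN ADDITIVE PRIME, POINTS SIDE, for `E/ℚ`:
`Addv W p ⟹ log(E(ℚ_p)) = p^{t − v_p c_p} ℤ_p`** — every prime `p` (`2`, `3` included), no hypothesis
on `E(ℚ_p)[p]` or on the image of `ρ̄`; the `ℤ_p`-dual of ROUTE-1 (I2)
`exp*_ω(H¹_s(ℚ_p, T)) = p^{v_p c_p − t} ℤ_p` (whose Galois half is the typed DICT3).
[cite: Kim2022StructureSelmer, §3.2.3 (display before Thm. 3.7) and Lemma 3.10 (PDF pp. 16–17)]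
[cite: SilvermanAEC2009, IV.6.4, VII.6.1, VII.6.3] -/
theorem range_padicLog_baseChange_of_addv (hadd : Addv W p) :
    (padicLog (W.baseChange ℚ_[p])).range = (Submodule.span ℤ_[p] {(p : ℚ_[p]) ^
      ((padicValNat p (Nat.card (AddCommGroup.torsion (W.baseChange ℚ_[p]).toAffine.Point)) : ℤ) -
        padicValNat p ((W.baseChange ℚ_[p]).localTamagawaNumber ℤ_[p]))}).toAddSubgroup := by
  haveI := hasAdditiveReduction_baseChange_padic_of_addv W p hadd
  exact range_padicLog_eq_span_zpow_of_hasAdditiveReduction (W.baseChange ℚ_[p])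

/-- **Kim's Lemma 3.10 regime for `E/ℚ`**: `Addv W p` and `p ∤ c_p` (automatic for `p ≥ 5`) give
`log(E(ℚ_p)) = p^t ℤ_p`. [cite: Kim2022StructureSelmer, Lemma 3.10 and Remark 3.8 (PDF pp. 16–17)] -/
theorem range_padicLog_baseChange_of_addv_of_not_dvd (hadd : Addv W p)
    (hcp : ¬ p ∣ (W.baseChange ℚ_[p]).localTamagawaNumber ℤ_[p]) :
    (padicLog (W.baseChange ℚ_[p])).range = (Submodule.span ℤ_[p] {(p : ℚ_[p]) ^
      padicValNat p (Nat.card (AddCommGroup.torsion (W.baseChange ℚ_[p]).toAffine.Point))}).toAddSubgroup := by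
  haveI := hasAdditiveReduction_baseChange_padic_of_addv W p hadd
  exact range_padicLog_eq_span_pow_of_hasAdditiveReduction_of_not_dvd (W.baseChange ℚ_[p]) hcp

/-- **Class X4 (`p ≠ 2`, additive, `E[p]` irreducible) — the N10/N11 rows at `p = 3`:**
`log(E(ℚ_p)) = p^{t − v_p c_p} ℤ_p` (only the `Addv` conjunct is used). [cite: Kim2022StructureSelmer, §3.2.3 (display before Thm. 3.7, PDF p. 16)] -/
theorem range_padicLog_baseChange_of_classX4 (hX4 : ClassX4 W p) :
    (padicLog (W.baseChange ℚ_[p])).range = (Submodule.span ℤ_[p] {(p : ℚ_[p]) ^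
      ((padicValNat p (Nat.card (AddCommGroup.torsion (W.baseChange ℚ_[p]).toAffine.Point)) : ℤ) -
        padicValNat p ((W.baseChange ℚ_[p]).localTamagawaNumber ℤ_[p]))}).toAddSubgroup :=
  range_padicLog_baseChange_of_addv W p hX4.2.1

/-- **Class X3 (`E[p]` reducible, additive):** `log(E(ℚ_p)) = p^{t − v_p c_p} ℤ_p`.
[cite: Kim2022StructureSelmer, §3.2.3 (display before Thm. 3.7, PDF p. 16)] -/
theorem range_padicLog_baseChange_of_classX3 (hX3 : ClassX3 W p) :
    (padicLog (W.baseChange ℚ_[p])).range = (Submodule.span ℤ_[p] {(p : ℚ_[p]) ^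
      ((padicValNat p (Nat.card (AddCommGroup.torsion (W.baseChange ℚ_[p]).toAffine.Point)) : ℤ) -
        padicValNat p ((W.baseChange ℚ_[p]).localTamagawaNumber ℤ_[p]))}).toAddSubgroup :=
  range_padicLog_baseChange_of_addv W p hX3.2

/-! ## §3 The `exp*` side as the DUAL LATTICE (pure algebra; the `p`-adic Hodge dictionary stays typed) -/

omit [W.IsElliptic] [W.IsGloballyMinimal] in
/-- **The dual of `p^a ℤ_p` under multiplication is `p^{−a} ℤ_p`**: `x · (p^a ℤ_p) ⊆ ℤ_p ↔ x ∈ p^{−a} ℤ_p`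
(membership in `ℤ_p ⊂ ℚ_p` written `‖·‖ ≤ 1`). This is the only algebra between the points side
`log_ω(E(ℚ_p)) = p^a ℤ_p` and the Galois side `exp*_ω(H¹_s(ℚ_p, T)) = p^{−a} ℤ_p` of the local index,
GIVEN the (typed, not tree) dictionary `⟨x, y⟩ = exp*_ω(x) · log_ω(y)` perfect on
`H¹_s × E(ℚ_p) ⊗ ℤ_p/tors` (Kato, Astérisque 295, proof of Lemma 14.18; Kim, AJM 148, §3.2.3).
[cite: Kim2022StructureSelmer, §3.2.3 (display before Thm. 3.7, PDF p. 16)] -/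
theorem forall_norm_mul_le_one_iff_mem_span_zpow_neg (a : ℤ) (x : ℚ_[p]) :
    (∀ y ∈ (Submodule.span ℤ_[p] {(p : ℚ_[p]) ^ a}).toAddSubgroup, ‖x * y‖ ≤ 1) ↔
      x ∈ (Submodule.span ℤ_[p] {(p : ℚ_[p]) ^ (-a)}).toAddSubgroup := by
  have hp0 : (p : ℚ_[p]) ≠ 0 := Nat.cast_ne_zero.mpr hp.out.ne_zero
  have hpa : (p : ℚ_[p]) ^ a ≠ 0 := zpow_ne_zero a hp0
  constructor
  · intro h
    have h1 : ‖x * (p : ℚ_[p]) ^ a‖ ≤ 1 :=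
      h _ (by rw [Submodule.mem_toAddSubgroup]; exact Submodule.mem_span_singleton_self _)
    rw [Submodule.mem_toAddSubgroup, Submodule.mem_span_singleton]
    refine ⟨⟨x * (p : ℚ_[p]) ^ a, h1⟩, ?_⟩
    rw [Algebra.smul_def, PadicInt.algebraMap_apply]
    change x * (p : ℚ_[p]) ^ a * (p : ℚ_[p]) ^ (-a) = x
    rw [mul_assoc, ← zpow_add₀ hp0, add_neg_cancel, zpow_zero, mul_one]
  · intro hx y hy
    rw [Submodule.mem_toAddSubgroup, Submodule.mem_span_singleton] at hx hy
    obtain ⟨c, rfl⟩ := hx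
    obtain ⟨d, rfl⟩ := hy
    rw [Algebra.smul_def, Algebra.smul_def, PadicInt.algebraMap_apply, PadicInt.algebraMap_apply,
      show (c : ℚ_[p]) * (p : ℚ_[p]) ^ (-a) * ((d : ℚ_[p]) * (p : ℚ_[p]) ^ a) =
        (c : ℚ_[p]) * (d : ℚ_[p]) * ((p : ℚ_[p]) ^ (-a) * (p : ℚ_[p]) ^ a) by ring,
      ← zpow_add₀ hp0, neg_add_cancel, zpow_zero, mul_one, ← PadicInt.coe_mul]
    exact (c * d).2

/-- **(I2) modulo the dictionary, for `E/ℚ` at an additive prime:** the multiplication-dual of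
`log(E(ℚ_p))` is `p^{v_p c_p − t} ℤ_p` — i.e. IF `exp*_ω(H¹_s(ℚ_p, T))` is the dual lattice of
`log_ω(E(ℚ_p))` under `⟨x, y⟩ = exp*_ω(x) · log_ω(y)` (typed DICT3, ROUTE-1 R1-21), THEN it equals
`p^{v_p c_p − t} ℤ_p`, r1's (I2) with `e = t` and `c₃ = 3` allowed.
[cite: Kim2022StructureSelmer, §3.2.3 (display before Thm. 3.7) and Lemma 3.10 (PDF pp. 16–17)] -/
theorem dual_range_padicLog_baseChange_of_addv (hadd : Addv W p) (x : ℚ_[p]) :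
    (∀ y ∈ (padicLog (W.baseChange ℚ_[p])).range, ‖x * y‖ ≤ 1) ↔
      x ∈ (Submodule.span ℤ_[p] {(p : ℚ_[p]) ^
        ((padicValNat p ((W.baseChange ℚ_[p]).localTamagawaNumber ℤ_[p]) : ℤ) -
          padicValNat p (Nat.card (AddCommGroup.torsion (W.baseChange ℚ_[p]).toAffine.Point)))}).toAddSubgroup := by
  rw [range_padicLog_baseChange_of_addv W p hadd, forall_norm_mul_le_one_iff_mem_span_zpow_neg, neg_sub]

end Summit.BirchSwinnertonDyer.Rank1Residual.Additive.LocalLog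

end
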